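import Summits.QuantumFields.YangMills.Theorems.BalabanUVNodesN18AvgRemainderCoarseDiff
import Summits.QuantumFields.YangMills.Theorems.UnitScaleTiltProp7CombGauge
import Literature.MathematicalPhysics.QuantumFieldTheory.Balaban1983to89.BlockAveragingFederbush
import Literature.MathematicalPhysics.QuantumFieldTheory.Balaban1983to89.B10Eq32AxialSuN

/-!
# BalabanUVNodes ∕ node N18 = NE5 — closure-ledger item (iii), (β3) letters: (I) THE LOGARITHM OF A TWO-SIDED CONJUGATION OF NEAR-IDENTITY ELEMENTS, EXP-FREE —
# `log(XWZ) − (log X + log W + log Z) = D(XWZ) − D(X) − D(W) − D(Z) + (X − 1)(WZ − 1) + (W − 1)(Z − 1)` with the log defect `D(Y) = log Y − (Y − 1)`; hence the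
# conjugation remainder is SECOND ORDER (`≤ 1300·t²` on the ball `‖X − 1‖, ‖Z − 1‖ ≤ 2t`, `‖W − 1‖ ≤ 14t`, `48t ≤ 1`) and LIPSCHITZ WITH THE SMALLNESS FACTOR (`≤ 2000·t·u`);
# (II) THE COMB MEANS `λ̄_A = combMean A` OF [Balaban1985Averaging] (62): differences, TRANSLATION COVARIANCE `λ̄_{A∘τ_{La}}(y) = λ̄_A(y + a)`, size of `iξλ̄_A`, and
# THE COMB GAUGE `exp(±iξλ̄_A) ∈ SU(N)` for Hermitian traceless `A`
# (Track A, DAG node N18 = `T4OutputRate.NE5` :211; cluster K4 «SpineRates», item K3⁷ `SpineGivenEndpointR13SepCoPH`; WIDTH SEAT pub-ymgap-dag-n18-w3 g2, file 3a)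

HONEST FRAMING.  Count-neutral kernel bookkeeping (`--supports stmt-QuantumFields-20544 --as helper`); elementary Banach-algebra calculus, PROVED: a `noncomm_ring`
identity (the second-order identity behind [Balaban1987RG1] (0.8), `FederbushMean.mlog_mul_sub_sub_eq`, applied twice — the middle defect `D(WZ)` cancels) and the
Federbush letters of the series logarithm (`norm_mlog_sub_sub_one_le_of_le`: `‖D(Y)‖ ≤ s²∕(1−s)`; `norm_mlog_sub_mlog_sub_le`: `D` is `s∕(1−s)`-Lipschitz on `‖· − 1‖ ≤ s`).
No BCH series.  NE5 is NOT PRINTED and NOT proved; N18 is NOT discharged.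

WHY.  The comb gauge `v = exp λ̄` of [Balaban1985Averaging] (62)–(63)∕(93) enters the (1.12) transport ((β3) of seat pub-ymgap-dag-n18-d's `N18-BETA-SPEC.md`) as a
two-sided conjugation `V(c) = v(c₋)⁻¹·Ū(c)·v(c₊)` of the averaged field by near-identity group elements; the double-bar potential `log V` must be compared with
`log v(c₋)⁻¹ + log Ū(c) + log v(c₊)` to second order, in sup (C⁰) AND with a Lipschitz constant of first order (C¹, for the coarse-difference letter).  This file
supplies exactly that comparison for three abstract near-identity elements of a complete normed `ℂ`-algebra (§1), and the bookkeeping of the comb means the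
instantiation needs (§2: `combMean_sub'` from `Prop7CombGauge.combMean_add`; `combMean_translate` from dag-n18-d 26's `walkSum_translate` + `walk_translate` + `Site.emb_add`;
`norm_smul_combMean_le` from `Prop7LinAvgOnto.norm_combMean_le`); the sibling `…N18AvgPotentialCombGauge` instantiates §1 at `X = exp(−iξλ̄_A(c₋))`, `W = Ū(c)`,
`Z = exp(iξλ̄_A(c₊))`.

WHAT.  `mlog_mul_mul_sub_eq` (the identity), `norm_mul_sub_one_le_of_near`, `norm_mul_sub_mul_le_of_near` (products of near-identity elements: size, Lipschitz),
`norm_logDefect_le` (`‖D(Y)‖ ≤ 2s²`, `s ≤ 1∕2`), `norm_logDefect_sub_logDefect_le` (`‖D(Y) − D(Y′)‖ ≤ 2s‖Y − Y′‖`), ★ `norm_mlog_mul_mul_sub_le` (C⁰ `1300t²`),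
★ `norm_mlog_mul_mul_rem_sub_le` (C¹ `2000·t·u`); §2 `combMean_sub'`, ★ `combMean_translate`, `combMean_translate_shift`, `norm_smul_combMean_le`; §2c `walkSum_star`,
`star_combMean(_of_selfAdjoint)`, `trace_walkSum_eq_zero`, `trace_combMean_eq_zero`, ★ `exp_smul_combMean_mem_specialUnitaryGroup` (THE COMB GAUGE IS `SU(N)`-VALUED for
Hermitian traceless `A`, via `B10Eq32AxialSuN.exp_smul_mem_specialUnitaryGroup`).  Constants generous.

WHAT THIS IS NOT.  No estimate of Bałaban's; Banach-algebra and lattice bookkeeping only — not continuum ∕ OS ∕ mass gap ∕ Clay.  0 `def`, 0 `sorry`, standard axioms.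
-/

namespace YMDAG.N18.LogConjugation

open Literature.MathematicalPhysics.QuantumFieldTheory.Balaban1983to89
open Literature.MathematicalPhysics.QuantumFieldTheory.Balaban1983to89.MatrixLog (mlog)
open Literature.MathematicalPhysics.QuantumFieldTheory.Balaban1983to89.FederbushMean (norm_mlog_sub_mlog_sub_le norm_mlog_sub_sub_one_le_of_le)

/-! ## §1 The identity and the product letters -/


section Algebra

variable {𝔸 : Type*} [NormedRing 𝔸] [NormedAlgebra ℂ 𝔸] [CompleteSpace 𝔸]

omit [CompleteSpace 𝔸] in
/-- **THE LOGARITHM OF A TRIPLE PRODUCT, EXP-FREE**: `log(XWZ) − (log X + log W + log Z) = D(XWZ) − D(X) − D(W) − D(Z) + (X − 1)(WZ − 1) + (W − 1)(Z − 1)` with the log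
defect `D(Y) := log Y − (Y − 1)` — a ring identity (the second-order identity behind [Balaban1987RG1] (0.8), `FederbushMean.mlog_mul_sub_sub_eq`, applied twice; the middle
defect `D(WZ)` cancels). [folklore] -/
theorem mlog_mul_mul_sub_eq (X W Z : 𝔸) :
    mlog (X * W * Z) - (mlog X + mlog W + mlog Z) =
      (mlog (X * W * Z) - (X * W * Z - 1)) - (mlog X - (X - 1)) - (mlog W - (W - 1)) - (mlog Z - (Z - 1)) +
        (X - 1) * (W * Z - 1) + (W - 1) * (Z - 1) := by
  noncomm_ring

omit [NormedAlgebra ℂ 𝔸] [CompleteSpace 𝔸] in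
/-- `‖WZ − 1‖ ≤ w + z + wz` from `‖W − 1‖ ≤ w`, `‖Z − 1‖ ≤ z`. [folklore] -/
theorem norm_mul_sub_one_le_of_near {W Z : 𝔸} {w z : ℝ} (hW : ‖W - 1‖ ≤ w) (hZ : ‖Z - 1‖ ≤ z) : ‖W * Z - 1‖ ≤ w + z + w * z := by
  have hw0 : 0 ≤ w := (norm_nonneg _).trans hW
  have e : W * Z - 1 = (W - 1) + (Z - 1) + (W - 1) * (Z - 1) := by noncomm_ring
  rw [e]
  calc _ ≤ ‖W - 1‖ + ‖Z - 1‖ + ‖(W - 1) * (Z - 1)‖ := (norm_add_le _ _).trans (add_le_add (norm_add_le _ _) le_rfl)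
    _ ≤ w + z + w * z := add_le_add (add_le_add hW hZ) ((norm_mul_le _ _).trans (mul_le_mul hW hZ (norm_nonneg _) hw0))

omit [NormedAlgebra ℂ 𝔸] [CompleteSpace 𝔸] in
/-- `‖WZ − W′Z′‖ ≤ ‖W − W′‖(1 + z) + (1 + w)‖Z − Z′‖` for `‖W′ − 1‖ ≤ w`, `‖Z − 1‖ ≤ z` (`‖1‖ = 1`). [folklore] -/
theorem norm_mul_sub_mul_le_of_near [NormOneClass 𝔸] {W W' Z Z' : 𝔸} {w z : ℝ} (hW' : ‖W' - 1‖ ≤ w) (hZ : ‖Z - 1‖ ≤ z) :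
    ‖W * Z - W' * Z'‖ ≤ ‖W - W'‖ * (1 + z) + (1 + w) * ‖Z - Z'‖ := by
  have hZn : ‖Z‖ ≤ 1 + z := by
    have := norm_add_le (1 : 𝔸) (Z - 1); rw [add_sub_cancel, norm_one] at this; linarith
  have hW'n : ‖W'‖ ≤ 1 + w := by
    have := norm_add_le (1 : 𝔸) (W' - 1); rw [add_sub_cancel, norm_one] at this; linarith
  have e : W * Z - W' * Z' = (W - W') * Z + W' * (Z - Z') := by noncomm_ring
  rw [e]
  calc _ ≤ ‖(W - W') * Z‖ + ‖W' * (Z - Z')‖ := norm_add_le _ _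
    _ ≤ ‖W - W'‖ * ‖Z‖ + ‖W'‖ * ‖Z - Z'‖ := add_le_add (norm_mul_le _ _) (norm_mul_le _ _)
    _ ≤ ‖W - W'‖ * (1 + z) + (1 + w) * ‖Z - Z'‖ :=
        add_le_add (mul_le_mul_of_nonneg_left hZn (norm_nonneg _)) (mul_le_mul_of_nonneg_right hW'n (norm_nonneg _))

/-- The log defect is second order: `‖D(Y)‖ ≤ 2s²` for `‖Y − 1‖ ≤ s ≤ 1∕2` (`FederbushMean.norm_mlog_sub_sub_one_le_of_le`). [folklore] -/
theorem norm_logDefect_le {Y : 𝔸} {s : ℝ} (hY : ‖Y - 1‖ ≤ s) (hs : s ≤ 1 / 2) : ‖mlog Y - (Y - 1)‖ ≤ 2 * s ^ 2 := by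
  have hs0 : 0 ≤ s := (norm_nonneg _).trans hY
  have h := norm_mlog_sub_sub_one_le_of_le hY (by linarith)
  refine h.trans ?_
  rw [div_mul_eq_mul_div, div_le_iff₀ (by linarith)]
  nlinarith [mul_nonneg hs0 hs0]

/-- The log defect is Lipschitz with the smallness factor: `‖D(Y) − D(Y′)‖ ≤ 2s·‖Y − Y′‖` for `‖Y − 1‖, ‖Y′ − 1‖ ≤ s ≤ 1∕2`
(`FederbushMean.norm_mlog_sub_mlog_sub_le`). [folklore] -/
theorem norm_logDefect_sub_logDefect_le {Y Y' : 𝔸} {s : ℝ} (hY : ‖Y - 1‖ ≤ s) (hY' : ‖Y' - 1‖ ≤ s) (hs : s ≤ 1 / 2) :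
    ‖(mlog Y - (Y - 1)) - (mlog Y' - (Y' - 1))‖ ≤ 2 * s * ‖Y - Y'‖ := by
  have hs0 : 0 ≤ s := (norm_nonneg _).trans hY
  have h := norm_mlog_sub_mlog_sub_le (by linarith : s < 1) hY hY'
  have e : (mlog Y - (Y - 1)) - (mlog Y' - (Y' - 1)) = mlog Y - mlog Y' - (Y - Y') := by abel
  rw [e]
  refine h.trans (mul_le_mul_of_nonneg_right ?_ (norm_nonneg _))
  rw [div_le_iff₀ (by linarith)]
  nlinarith

omit [NormedAlgebra ℂ 𝔸] [CompleteSpace 𝔸] in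
/-- The triple product stays in the ball: `‖XWZ − 1‖ ≤ 20t` for `‖X − 1‖, ‖Z − 1‖ ≤ 2t`, `‖W − 1‖ ≤ 14t`, `48t ≤ 1`. [folklore] -/
theorem norm_mul_mul_sub_one_le {X W Z : 𝔸} {t : ℝ} (hX : ‖X - 1‖ ≤ 2 * t) (hW : ‖W - 1‖ ≤ 14 * t) (hZ : ‖Z - 1‖ ≤ 2 * t) (ht : 48 * t ≤ 1) :
    ‖X * W * Z - 1‖ ≤ 20 * t := by
  have ht0 : 0 ≤ t := by have := (norm_nonneg _).trans hX; linarith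
  have hM : ‖W * Z - 1‖ ≤ 17 * t := (norm_mul_sub_one_le_of_near hW hZ).trans (by nlinarith)
  rw [mul_assoc]; exact (norm_mul_sub_one_le_of_near hX hM).trans (by nlinarith)

/-- **C⁰: THE CONJUGATION REMAINDER IS SECOND ORDER.**  For `‖X − 1‖, ‖Z − 1‖ ≤ 2t`, `‖W − 1‖ ≤ 14t`, `48t ≤ 1`:
`‖log(XWZ) − (log X + log W + log Z)‖ ≤ 1300·t²`. [folklore] -/
theorem norm_mlog_mul_mul_sub_le {X W Z : 𝔸} {t : ℝ} (hX : ‖X - 1‖ ≤ 2 * t) (hW : ‖W - 1‖ ≤ 14 * t) (hZ : ‖Z - 1‖ ≤ 2 * t) (ht : 48 * t ≤ 1) :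
    ‖mlog (X * W * Z) - (mlog X + mlog W + mlog Z)‖ ≤ 1300 * t ^ 2 := by
  have ht0 : 0 ≤ t := by have := (norm_nonneg _).trans hX; linarith
  have hM : ‖W * Z - 1‖ ≤ 17 * t := (norm_mul_sub_one_le_of_near hW hZ).trans (by nlinarith)
  have hV : ‖X * W * Z - 1‖ ≤ 20 * t := by
    rw [mul_assoc]; exact (norm_mul_sub_one_le_of_near hX hM).trans (by nlinarith)
  have hDV := norm_logDefect_le hV (by linarith)
  have hDX := norm_logDefect_le hX (by linarith)
  have hDW := norm_logDefect_le hW (by linarith)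
  have hDZ := norm_logDefect_le hZ (by linarith)
  have hP1 : ‖(X - 1) * (W * Z - 1)‖ ≤ 2 * t * (17 * t) := (norm_mul_le _ _).trans (mul_le_mul hX hM (norm_nonneg _) (by linarith))
  have hP2 : ‖(W - 1) * (Z - 1)‖ ≤ 14 * t * (2 * t) := (norm_mul_le _ _).trans (mul_le_mul hW hZ (norm_nonneg _) (by linarith))
  rw [mlog_mul_mul_sub_eq]
  calc _ ≤ ‖mlog (X * W * Z) - (X * W * Z - 1)‖ + ‖mlog X - (X - 1)‖ + ‖mlog W - (W - 1)‖ + ‖mlog Z - (Z - 1)‖ +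
          ‖(X - 1) * (W * Z - 1)‖ + ‖(W - 1) * (Z - 1)‖ := by
        refine (norm_add_le _ _).trans (add_le_add ((norm_add_le _ _).trans (add_le_add ?_ le_rfl)) le_rfl)
        refine (norm_sub_le _ _).trans (add_le_add ((norm_sub_le _ _).trans (add_le_add ((norm_sub_le _ _).trans le_rfl) le_rfl)) le_rfl)
    _ ≤ 2 * (20 * t) ^ 2 + 2 * (2 * t) ^ 2 + 2 * (14 * t) ^ 2 + 2 * (2 * t) ^ 2 + 2 * t * (17 * t) + 14 * t * (2 * t) :=
        add_le_add (add_le_add (add_le_add (add_le_add (add_le_add hDV hDX) hDW) hDZ) hP1) hP2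
    _ = 1270 * t ^ 2 := by ring
    _ ≤ 1300 * t ^ 2 := by nlinarith [sq_nonneg t]

/-- **C¹: THE CONJUGATION REMAINDER IS LIPSCHITZ WITH THE SMALLNESS FACTOR.**  For two triples in the ball of `norm_mlog_mul_mul_sub_le` (`‖X − 1‖, ‖X′ − 1‖, ‖Z − 1‖,
‖Z′ − 1‖ ≤ 2t`, `‖W − 1‖, ‖W′ − 1‖ ≤ 14t`, `48t ≤ 1`) with `‖X − X′‖, ‖Z − Z′‖ ≤ 2u`, `‖W − W′‖ ≤ 22u`: the two remainders differ by at most `2000·t·u`. [folklore] -/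
theorem norm_mlog_mul_mul_rem_sub_le [NormOneClass 𝔸] {X X' W W' Z Z' : 𝔸} {t u : ℝ} (hu : 0 ≤ u)
    (hX : ‖X - 1‖ ≤ 2 * t) (hW : ‖W - 1‖ ≤ 14 * t) (hZ : ‖Z - 1‖ ≤ 2 * t)
    (hX' : ‖X' - 1‖ ≤ 2 * t) (hW' : ‖W' - 1‖ ≤ 14 * t) (hZ' : ‖Z' - 1‖ ≤ 2 * t) (ht : 48 * t ≤ 1)
    (hXX' : ‖X - X'‖ ≤ 2 * u) (hWW' : ‖W - W'‖ ≤ 22 * u) (hZZ' : ‖Z - Z'‖ ≤ 2 * u) :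
    ‖(mlog (X * W * Z) - (mlog X + mlog W + mlog Z)) - (mlog (X' * W' * Z') - (mlog X' + mlog W' + mlog Z'))‖ ≤ 2000 * t * u := by
  have ht0 : 0 ≤ t := by have := (norm_nonneg _).trans hX; linarith
  -- zeroth order sizes
  have hM : ‖W * Z - 1‖ ≤ 17 * t := (norm_mul_sub_one_le_of_near hW hZ).trans (by nlinarith)
  have hM' : ‖W' * Z' - 1‖ ≤ 17 * t := (norm_mul_sub_one_le_of_near hW' hZ').trans (by nlinarith)
  have hV : ‖X * W * Z - 1‖ ≤ 20 * t := by rw [mul_assoc]; exact (norm_mul_sub_one_le_of_near hX hM).trans (by nlinarith)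
  have hV' : ‖X' * W' * Z' - 1‖ ≤ 20 * t := by rw [mul_assoc]; exact (norm_mul_sub_one_le_of_near hX' hM').trans (by nlinarith)
  -- differences of the products
  have hMM' : ‖W * Z - W' * Z'‖ ≤ 26 * u := by
    refine (norm_mul_sub_mul_le_of_near hW' hZ).trans ?_
    calc ‖W - W'‖ * (1 + 2 * t) + (1 + 14 * t) * ‖Z - Z'‖ ≤ 22 * u * (1 + 2 * t) + (1 + 14 * t) * (2 * u) :=
          add_le_add (mul_le_mul_of_nonneg_right hWW' (by linarith)) (mul_le_mul_of_nonneg_left hZZ' (by linarith))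
      _ ≤ 26 * u := by nlinarith
  have hVV' : ‖X * W * Z - X' * W' * Z'‖ ≤ 30 * u := by
    rw [mul_assoc, mul_assoc]
    refine (norm_mul_sub_mul_le_of_near hX' hM).trans ?_
    calc ‖X - X'‖ * (1 + 17 * t) + (1 + 2 * t) * ‖W * Z - W' * Z'‖ ≤ 2 * u * (1 + 17 * t) + (1 + 2 * t) * (26 * u) :=
          add_le_add (mul_le_mul_of_nonneg_right hXX' (by linarith)) (mul_le_mul_of_nonneg_left hMM' (by linarith))
      _ ≤ 30 * u := by nlinarith
  -- the four defects
  have hDV := norm_logDefect_sub_logDefect_le hV hV' (by linarith)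
  have hDX := norm_logDefect_sub_logDefect_le hX hX' (by linarith)
  have hDW := norm_logDefect_sub_logDefect_le hW hW' (by linarith)
  have hDZ := norm_logDefect_sub_logDefect_le hZ hZ' (by linarith)
  -- the two products
  have hP1 : ‖(X - 1) * (W * Z - 1) - (X' - 1) * (W' * Z' - 1)‖ ≤ 2 * u * (17 * t) + 2 * t * (26 * u) := by
    have e : (X - 1) * (W * Z - 1) - (X' - 1) * (W' * Z' - 1) = (X - X') * (W * Z - 1) + (X' - 1) * (W * Z - W' * Z') := by noncomm_ring
    rw [e]
    have h1 : ‖X - X'‖ * ‖W * Z - 1‖ ≤ 2 * u * (17 * t) := mul_le_mul hXX' hM (norm_nonneg _) (by linarith)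
    have h2 : ‖X' - 1‖ * ‖W * Z - W' * Z'‖ ≤ 2 * t * (26 * u) := mul_le_mul hX' hMM' (norm_nonneg _) (by linarith)
    exact (norm_add_le _ _).trans (add_le_add ((norm_mul_le _ _).trans h1) ((norm_mul_le _ _).trans h2))
  have hP2 : ‖(W - 1) * (Z - 1) - (W' - 1) * (Z' - 1)‖ ≤ 22 * u * (2 * t) + 14 * t * (2 * u) := by
    have e : (W - 1) * (Z - 1) - (W' - 1) * (Z' - 1) = (W - W') * (Z - 1) + (W' - 1) * (Z - Z') := by noncomm_ring
    rw [e]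
    have h1 : ‖W - W'‖ * ‖Z - 1‖ ≤ 22 * u * (2 * t) := mul_le_mul hWW' hZ (norm_nonneg _) (by linarith)
    have h2 : ‖W' - 1‖ * ‖Z - Z'‖ ≤ 14 * t * (2 * u) := mul_le_mul hW' hZZ' (norm_nonneg _) (by linarith)
    exact (norm_add_le _ _).trans (add_le_add ((norm_mul_le _ _).trans h1) ((norm_mul_le _ _).trans h2))
  rw [mlog_mul_mul_sub_eq, mlog_mul_mul_sub_eq]
  have e : ∀ (a b c d p q a' b' c' d' p' q' : 𝔸), (a - b - c - d + p + q) - (a' - b' - c' - d' + p' + q') =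
      (a - a') - (b - b') - (c - c') - (d - d') + (p - p') + (q - q') := fun _ _ _ _ _ _ _ _ _ _ _ _ => by abel
  rw [e]
  calc _ ≤ ‖(mlog (X * W * Z) - (X * W * Z - 1)) - (mlog (X' * W' * Z') - (X' * W' * Z' - 1))‖ +
          ‖(mlog X - (X - 1)) - (mlog X' - (X' - 1))‖ + ‖(mlog W - (W - 1)) - (mlog W' - (W' - 1))‖ +
          ‖(mlog Z - (Z - 1)) - (mlog Z' - (Z' - 1))‖ +
          ‖(X - 1) * (W * Z - 1) - (X' - 1) * (W' * Z' - 1)‖ + ‖(W - 1) * (Z - 1) - (W' - 1) * (Z' - 1)‖ := by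
        refine (norm_add_le _ _).trans (add_le_add ((norm_add_le _ _).trans (add_le_add ?_ le_rfl)) le_rfl)
        refine (norm_sub_le _ _).trans (add_le_add ((norm_sub_le _ _).trans (add_le_add ((norm_sub_le _ _).trans le_rfl) le_rfl)) le_rfl)
    _ ≤ 2 * (20 * t) * (30 * u) + 2 * (2 * t) * (2 * u) + 2 * (14 * t) * (22 * u) + 2 * (2 * t) * (2 * u) +
          (2 * u * (17 * t) + 2 * t * (26 * u)) + (22 * u * (2 * t) + 14 * t * (2 * u)) := by
        refine add_le_add (add_le_add (add_le_add (add_le_add (add_le_add ?_ ?_) ?_) ?_) hP1) hP2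
        · exact hDV.trans (mul_le_mul_of_nonneg_left hVV' (by positivity))
        · exact hDX.trans (mul_le_mul_of_nonneg_left hXX' (by positivity))
        · exact hDW.trans (mul_le_mul_of_nonneg_left hWW' (by positivity))
        · exact hDZ.trans (mul_le_mul_of_nonneg_left hZZ' (by positivity))
    _ = 1990 * t * u := by ring
    _ ≤ 2000 * t * u := by nlinarith [mul_nonneg ht0 hu]

end Algebra

end YMDAG.N18.LogConjugation

open scoped BigOperators

namespace YMDAG.N18.AvgPotential

open Literature.MathematicalPhysics.QuantumFieldTheory.Balaban1983to89

/-! ## §2 Bookkeeping of the comb means `λ̄_A = combMean A` (the comb gauge `g = exp(iξλ̄_A)` of [Balaban1985Averaging] (62)) -/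

section CombGauge

open Literature.MathematicalPhysics.QuantumFieldTheory.Balaban1983to89.T4Continuum
open Literature.MathematicalPhysics.QuantumFieldTheory.Balaban1983to89.BlockAveraging
open Literature.MathematicalPhysics.QuantumFieldTheory.Balaban1983to89.BlockAveragingEMLLinearised (walkSum combMean combMean_def)
open YMDAG.N18.HolonomyLipschitz (walkSum_translate)
open Summit.QuantumFields.YangMills.Theorems.Prop7LinAvgOnto (norm_combMean_le)
open Summit.QuantumFields.YangMills.Theorems.Prop7CombGauge (combMean_add)

open scoped Matrix.Norms.L2Operator

variable {n : Type*} [Fintype n] [DecidableEq n] [Nonempty n] {P : Params} {j : ℕ}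

/-- `scale e_ν = L • e_ν` one level down (public twin `B13AvgCorrKappaOneLetters.scale_zero_shift` in the T⁴ `Support` tree, not imported; kept private). [folklore] -/
private theorem scale_zero_shift'' (ν : Fin P.d) : Site.scale ((0 : Site P (j + 1)).shift ν) = P.L • (0 : Site P j).shift ν := by
  funext κ
  show Site.scaleCoord P j (((0 : Site P (j + 1)).shift ν) κ) = P.L • (((0 : Site P j).shift ν) κ)
  by_cases h : κ = ν
  · have h1 : ((0 : Site P (j + 1)).shift ν) κ = 1 := by rw [Site.shift_apply, if_pos h, Site.zero_apply, zero_add]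
    have h2 : ((0 : Site P j).shift ν) κ = 1 := by rw [Site.shift_apply, if_pos h, Site.zero_apply, zero_add]
    rw [h1, h2, Site.scaleCoord_one, nsmul_eq_mul, mul_one]
  · have h1 : ((0 : Site P (j + 1)).shift ν) κ = 0 := by rw [Site.shift_apply, if_neg h, Site.zero_apply]
    have h2 : ((0 : Site P j).shift ν) κ = 0 := by rw [Site.shift_apply, if_neg h, Site.zero_apply]
    rw [h1, h2, map_zero, smul_zero]

/-! ### §2a Differences and translations -/

omit [Fintype n] [DecidableEq n] [Nonempty n] in
/-- The comb mean of a difference (from `Prop7CombGauge.combMean_add`). [cite: Balaban1985Averaging, (62) p.28] -/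
theorem combMean_sub' (A A' : PBond P j → Matrix n n ℂ) (y : Site P (j + 1)) :
    combMean (fun b => A b - A' b) y = combMean A y - combMean A' y := by
  have h := combMean_add (fun b => A b - A' b) A' y
  have hfun : (fun b => (A b - A' b) + A' b) = A := funext fun b => sub_add_cancel _ _
  rw [hfun] at h
  rw [h, add_sub_cancel_right]

omit [Fintype n] [DecidableEq n] [Nonempty n] in
/-- **THE COMB MEANS ARE TRANSLATION-COVARIANT**: `λ̄_{A∘τ_{La}}(y) = λ̄_A(y + a)` (the staircases from `emb (y + a) = emb y + La` are the translates of those from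
`emb y`; `walkSum_translate`, `walk_translate`, `Site.emb_add`). [cite: Balaban1985Averaging, (62) p.28; Balaban1987RG1, (2.17) p.269] -/
theorem combMean_translate (a : Site P (j + 1)) (A : PBond P j → Matrix n n ℂ) (y : Site P (j + 1)) :
    combMean (fun b => A (b.translate (Site.scale a))) y = combMean A (y + a) := by
  rw [combMean_def, combMean_def]
  congr 1
  refine Finset.sum_congr rfl fun i _ => ?_
  rw [walkSum_translate, ← walk_translate, Site.emb_add]

omit [Fintype n] [DecidableEq n] [Nonempty n] in
/-- `λ̄_{A∘τ_{Le_ν}}(y) = λ̄_A(y + e_ν)` (`scale e_ν = L·e_ν`). [cite: Balaban1985Averaging, (62) p.28] -/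
theorem combMean_translate_shift (A : PBond P j → Matrix n n ℂ) (y : Site P (j + 1)) (ν : Fin P.d) :
    combMean (fun b => A (b.translate (P.L • (0 : Site P j).shift ν))) y = combMean A (y.shift ν) := by
  rw [← scale_zero_shift'', combMean_translate, Site.add_zero_shift]

/-! ### §2b The size of the gauge exponent -/

omit [Nonempty n] in
/-- `‖iξ·λ̄_A(y)‖ ≤ ξ·(ℓr)` for `‖A_b‖ ≤ r` (`Prop7LinAvgOnto.norm_combMean_le`). [cite: Balaban1985Averaging, (62)-(63) p.28] -/
theorem norm_smul_combMean_le (A : PBond P j → Matrix n n ℂ) {ξ r : ℝ} (hξ : 0 ≤ ξ) (hr : 0 ≤ r) (hA : ∀ b, ‖A b‖ ≤ r) (y : Site P (j + 1)) :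
    ‖(Complex.I * ξ : ℂ) • combMean A y‖ ≤ ξ * ((((P.d + 2) * P.L : ℕ) : ℝ) * r) := by
  rw [norm_smul, norm_mul, Complex.norm_I, one_mul, Complex.norm_real, Real.norm_of_nonneg hξ]
  exact mul_le_mul_of_nonneg_left (norm_combMean_le A hr hA y) hξ

end CombGauge

/-! ### §2c The comb gauge is `SU(N)`-valued for Hermitian traceless potentials -/

section SU

open Literature.MathematicalPhysics.QuantumFieldTheory.Balaban1983to89.T4Continuum
open Literature.MathematicalPhysics.QuantumFieldTheory.Balaban1983to89.BlockAveragingEMLLinearised (walkSum walkSum_cons walkSum_nil combMean combMean_def)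

variable {m : Type*} {P : Params} {j : ℕ}

/-- `star` of a signed walk sum is the signed walk sum of the starred field. [folklore] -/
theorem walkSum_star (A : PBond P j → Matrix m m ℂ) :
    ∀ γ : List (LStep P j), walkSum (fun b => star (A b)) γ = star (walkSum A γ)
  | [] => by simp
  | s :: γ => by
    rw [walkSum_cons, walkSum_cons, walkSum_star A γ, star_add]
    split_ifs
    · rfl
    · rw [star_neg]

/-- `star` of a comb mean is the comb mean of the starred field (the weights `|I|⁻¹` are real). [cite: Balaban1985Averaging, (62) p.28 (bookkeeping)] -/
theorem star_combMean (A : PBond P j → Matrix m m ℂ) (y : Site P (j + 1)) :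
    star (combMean A y) = combMean (fun b => star (A b)) y := by
  rw [combMean_def, combMean_def, star_smul, star_sum]
  simp_rw [walkSum_star]
  congr 1
  rw [star_inv₀, Complex.star_def, Complex.conj_natCast]

/-- The comb mean of a bondwise HERMITIAN potential is Hermitian. [cite: Balaban1985Averaging, (62) p.28 (bookkeeping)] -/
theorem star_combMean_of_selfAdjoint {A : PBond P j → Matrix m m ℂ} (hA : ∀ b, star (A b) = A b) (y : Site P (j + 1)) :
    star (combMean A y) = combMean A y := by
  rw [star_combMean]; simp_rw [hA]

/-- The trace of a signed walk sum of TRACELESS matrices vanishes. [folklore] -/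
theorem trace_walkSum_eq_zero [Fintype m] {A : PBond P j → Matrix m m ℂ} (hA : ∀ b, Matrix.trace (A b) = 0) :
    ∀ γ : List (LStep P j), Matrix.trace (walkSum A γ) = 0
  | [] => by simp
  | s :: γ => by
    rw [walkSum_cons, Matrix.trace_add, trace_walkSum_eq_zero hA γ, add_zero]
    split_ifs
    · exact hA _
    · rw [Matrix.trace_neg, hA, neg_zero]

/-- The comb mean of a bondwise TRACELESS potential is traceless. [cite: Balaban1985Averaging, (62) p.28 (bookkeeping)] -/
theorem trace_combMean_eq_zero [Fintype m] {A : PBond P j → Matrix m m ℂ} (hA : ∀ b, Matrix.trace (A b) = 0) (y : Site P (j + 1)) :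
    Matrix.trace (combMean A y) = 0 := by
  rw [combMean_def, Matrix.trace_smul, Matrix.trace_sum]
  simp_rw [trace_walkSum_eq_zero hA]
  rw [Finset.sum_const_zero, smul_zero]

/-- ★ **THE COMB GAUGE IS `SU(N)`-VALUED**: for a bondwise Hermitian traceless potential `A` (`U_b = exp(iξA_b) ∈ SU(N)`), the gauge factors
`g(y)^{±1} = exp(±iξ·λ̄_A(y))` of the double bar lie in `SU(N)` (`B10Eq32AxialSuN.exp_smul_mem_specialUnitaryGroup`: skew-Hermitian traceless exponent). [cite: Balaban1985Averaging, (62)-(63) p.28] -/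
theorem exp_smul_combMean_mem_specialUnitaryGroup {N : ℕ} {A : PBond P j → Matrix (Fin N) (Fin N) ℂ} (hA : ∀ b, star (A b) = A b)
    (htr : ∀ b, Matrix.trace (A b) = 0) (ξ : ℝ) (y : Site P (j + 1)) :
    NormedSpace.exp ((Complex.I * ξ : ℂ) • combMean A y) ∈ Matrix.specialUnitaryGroup (Fin N) ℂ ∧
      NormedSpace.exp ((Complex.I * ξ : ℂ) • (-combMean A y)) ∈ Matrix.specialUnitaryGroup (Fin N) ℂ := by
  have hstar : star (Complex.I • combMean A y) = -(Complex.I • combMean A y) := by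
    rw [star_smul, Complex.star_def, Complex.conj_I, star_combMean_of_selfAdjoint hA, neg_smul]
  have htr0 : Matrix.trace (Complex.I • combMean A y) = 0 := by rw [Matrix.trace_smul, trace_combMean_eq_zero htr, smul_zero]
  have hstar' : star (Complex.I • (-combMean A y)) = -(Complex.I • (-combMean A y)) := by
    rw [smul_neg, star_neg, hstar]
  have htr0' : Matrix.trace (Complex.I • (-combMean A y)) = 0 := by rw [smul_neg, Matrix.trace_neg, htr0, neg_zero]
  have h1 := B10Eq32AxialSuN.exp_smul_mem_specialUnitaryGroup N hstar htr0 ξ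
  have h2 := B10Eq32AxialSuN.exp_smul_mem_specialUnitaryGroup N hstar' htr0' ξ
  rw [smul_smul, mul_comm (ξ : ℂ)] at h1 h2
  exact ⟨h1, h2⟩

end SU


end YMDAG.N18.AvgPotential
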